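import Summits.BirchSwinnertonDyer.BirchSwinnertonDyer.Theorems.KimAtThreeShallowEqDeepNonAdditiveOfKatoV2
import Summits.BirchSwinnertonDyer.BirchSwinnertonDyer.Theorems.KimAtThreeShallowEqDeepKatoV2OfPosition
import HarnessLib

/-!
# Route `KimAtThreeKolyvagin` (W2): items 20275 · 20397 and the NON-ADDITIVE half of cruxes 19599 / 19077 BY NAME, FROM the leaves,
# SIX cite facts and the ONE displayed Kato package with 3-adic POSITION hKatoPosʷ («Kato-only ∧ POS»)
# (cell `bsd-addord`, seat w2-c4 gen 12; `--supports` 19077, helper)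

HONEST FRAMING.  END-TYPE THEOREMS WITH DISPLAYED HYPOTHESES (no definition, no named fact, no instance, no `sorry`): the route
leaves are ROUTE DECLS or cite-only named facts carried as hypotheses; the six cite facts (S5a) `expStarCoord_eq_zero_iff_kummer`,
(S5b) `exists_smul_range_expStarCoord_iff_trace_log`, (S5b-tower) `exists_smul_range_expStarCoord_tower_iff_trace_log`, (P123)
`cupLogInjective_and_hasDualExp_of_isDeRham`, (DR) `isDeRham_restrictedRationalTateRep` are Literature `def … : Prop` facts
taken as hypotheses (D-0014); hKatoPosʷ (section variable `hKatoPos`, = the hypothesis of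
`KimAtThreeShallowEqDeepKatoV2OfPosition.katoV2W_of_katoPosW_of_facts`) is DISPLAYED: at every `3`-adic-tower row with a
lattice-optimal parametrisation at the conductor, SOME generator `d` of the Néron line at `ℚ_{v₃}` (NO Prop-1.2.3 binder, NO duality
clause), `(ι, κK, Λ)` with `κK ≠ 0`, the POSITION clause `POS(d, κK)` («IF `e • d` is duality-normalised THEN `v₃(κK) = v(e)`»),
the inner Kato block (RES₀)/(DEF₀) pinning `Λ_{0,r}` to the DEFINED `exp*_{d_w}` at every level / place / chart, and Kato's `ZetaBody`
family — Kato 2004 (8.1.3)/8.12/9.7∘6.6(1)/13.3 over the defined dual exponential of SOME generator, plus the relative 3-adic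
position of that generator and the Néron/duality line.  Item 20398 (additive-defect rows, seat acc3) stays a ROUTE-DECL hypothesis.
Nothing is closed or booked; 19560 / 19599 / 19077 / 20275 / 20397 / 20398 stay OPEN; BSD is not proved by any of this.

WHAT (each = the `…_of_katoV2_of_facts` form of `KimAtThreeShallowEqDeepNonAdditiveOfKatoV2` / `…WeightedItemOfKatoV2` ∘
`katoV2W_of_katoPosW_of_facts`):
* `definedKatoWeightedNonAdditiveThree_of_katoPos_of_facts` — item 20275 BY NAME;
* `fineKatoTauAnomalousThree_of_katoPos_of_facts` — item 20397 BY NAME;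
* `stub19599_nonAdditive_of_katoPos_of_facts` — crux 19599's `stub_nonAdditive` (BC3 text VERBATIM);
* `shallowEqDeepOffKatoStratum_of_katoPos_of_facts` — crux 19599 BY NAME ⟸ 3 route leaves ∧ 5 cite facts ∧ hKatoPosʷ ∧ item 20398;
* `shallowEqDeepAtTorsionFree_of_katoPos_of_facts` — crux 19077 BY NAME ⟸ the same ∧ `CarayolLevelEqConductor ∧ KatoKuriharaPortThreeShared`.
READING (08-28, W2 shallow cruxes — this seat's proposal): on EVERY non-additive `t = 0` row the ONLY non-cite, non-Kato displayed
content is POS — the period-position statement of crux 19077's docstring («Kato's optimal period vs `Ω⁺_f`»: Manin constant / `c_P`),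
the exact off-stratum twin of crux 19560's terminal residual (kim3 LEAD ruling 2026-08-27, hKatoPrintPos₀ / hKatoLitPos = «Kato
Literature fact ∧ POS» on the stratum); the Kato block of hKatoPosʷ is the matter of the Literature fact
`Kato2004.exists_eulerSystem_definedExpStar_values` (w2-c2 `KimAtThreeDeepLowerKatoLit.katoExact_of_lit`, hKatoExᵘ).
References: [Kato2004Asterisque] (8.1.3), 8.12, §9.4, 9.7, 6.6 (1), 13.3; [Kato1993LNM1553] II §1.2.4, 1.3.5, 1.4.1; [BlochKato1990]
§3 Prop. 3.8, Ex. 3.11; [Kim2022StructureSelmer] Thm. 1.9 (6), §3.2.3, 3.4, 3.5, 3.13; [Kim2025RefinedTNC] Thm. 1.1/1.2; [Sakamoto2024]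
Thm. 4.4; [MazurRubin2004] Thm. 4.4.1, 5.2.12; [Carayol1986].
-/

set_option autoImplicit false

noncomputable section

-- the cell's Theorems namespace `Summit.BirchSwinnertonDyer.BirchSwinnertonDyer.…` repeats the summit name by design (D-0017)
set_option linter.dupNamespace false

open scoped Classical NumberField TensorProduct ContRepresentation Pointwise
open Field ValuativeRel Function IsDedekindDomain NumberField
open WeierstrassCurve Literature.NumberTheory.EllipticCurves Literature.NumberTheory.GaloisRepresentations
  Literature.NumberTheory.GaloisRepresentations.DiscreteGaloisModule Literature.NumberTheory.GaloisCohomology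
open Literature.NumberTheory.GaloisRepresentations.PeriodRingData Literature.NumberTheory.PAdicHodge Literature.NumberTheory.EllipticCurves.ModularForms Literature.NumberTheory.EllipticCurves.Rank1Residual
open Literature.NumberTheory.EllipticCurves.Kato2004 Literature.NumberTheory.EllipticCurves.Kato2004.EulerSystemValues
open Literature.NumberTheory.AdelicBaseChange Literature.NumberTheory.Automorphic
open Summit.BirchSwinnertonDyer.Rank1Residual.GaloisImage Summit.BirchSwinnertonDyer.Rank1Residual.Additive.LocalLog
open Summit.BirchSwinnertonDyer.BirchSwinnertonDyer.Theorems
open Summit.BirchSwinnertonDyer.BirchSwinnertonDyer.Theorems.KimAtThreeFineKatoLevelCompat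
open Summit.BirchSwinnertonDyer.BirchSwinnertonDyer.Theorems.KimAtThreeFineKatoPerFactorDefined
open Summit.BirchSwinnertonDyer.BirchSwinnertonDyer.Theorems.KimAtThreeFineKatoPerFactorDefinedTwist
open Summit.BirchSwinnertonDyer.BirchSwinnertonDyer.Theorems.KimAtThreeDeepLowerExpStarOmega
open Summit.BirchSwinnertonDyer.BirchSwinnertonDyer.Theorems.KimAtThreeDeepLowerExpStarOmegaPlace
open Summit.BirchSwinnertonDyer.BirchSwinnertonDyer.Theorems.KimAtThreeFineKatoPerFactorPlaces
open Summit.BirchSwinnertonDyer.BirchSwinnertonDyer.Theorems.KimAtThreeDeepUpperExpStarFacts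
open Summit.BirchSwinnertonDyer.Rank1Residual.GaloisImage.TameLevel (squarefree_cycLevel_zero)
open Summit.BirchSwinnertonDyer.BirchSwinnertonDyer.Theorems.KimAtThreeSemiLocalTraceDualCyc
open Summit.BirchSwinnertonDyer.BirchSwinnertonDyer.Theorems.KimAtThreeShallowEqDeepTraceDualLattice
open Summit.BirchSwinnertonDyer.BirchSwinnertonDyer.Theorems.KimAtThreeShallowEqDeepWildDifferentLocal
open Summit.BirchSwinnertonDyer.BirchSwinnertonDyer.Theorems.KimAtThreeShallowEqDeepRiderOfWeightedCompat
open Summit.BirchSwinnertonDyer.BirchSwinnertonDyer.Theses.KimAtThreeKolyvagin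
open Summit.BirchSwinnertonDyer.BirchSwinnertonDyer.Theorems.KimAtThreeShallowEqDeepNonAdditiveOfFineKato
  (hasGoodReductionAtPrime_three_of_not_dvd_conductorNorm)
open Summit.BirchSwinnertonDyer.BirchSwinnertonDyer.Theorems.KimAtThreeShallowEqDeepSplitGlueNoStub
  (shallowEqDeepAtTorsionFree_of_parts_noStub)
open Summit.BirchSwinnertonDyer.BirchSwinnertonDyer.Theorems.KimAtThreeShallowEqDeepWeightedItems
open Summit.BirchSwinnertonDyer.BirchSwinnertonDyer.Theorems.KimAtThreeShallowEqDeepWeightedOfKatoV2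
  (definedKatoWeighted_of_katoV2_of_facts)
open Summit.BirchSwinnertonDyer.BirchSwinnertonDyer.Theorems.KimAtThreeShallowEqDeepGoodOfDefinedKato
  (fineKatoτ_of_definedKatoTwist)
open Summit.BirchSwinnertonDyer.BirchSwinnertonDyer.Theorems.KimAtThreeShallowEqDeepNonAdditiveOfKatoV2
open Summit.BirchSwinnertonDyer.BirchSwinnertonDyer.Theorems.KimAtThreeShallowEqDeepKatoV2OfPosition

namespace Summit.BirchSwinnertonDyer.BirchSwinnertonDyer.Theorems.KimAtThreeShallowEqDeepNonAdditiveOfPosition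

/-- Local notation: the `stub_nonAdditive` signature of crux 19599 (BC3 birth skeleton
`Cruxes/ShallowEqDeepOffKatoStratum/Lines/birth.lean`), VERBATIM. -/
local notation3 (prettyPrint := false) "STUB19599NA" =>
  ∀ (W₀ : WeierstrassCurve ℚ) [W₀.IsElliptic] [W₀.IsGloballyMinimal],
    (∀ n : ℕ, W₀.HasSurjectiveModNGaloisRep (3 ^ n : ℕ)) →
    Nat.card {Q : (W₀.baseChange ℚ_[3]).toAffine.Point // (3 : ℕ) • Q = 0} = 1 → Finite W₀.sha →
    ∀ {N : ℕ} [NeZero N], N = W₀.conductorNorm ℤ →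
    ∀ (D₀ : Literature.NumberTheory.EllipticCurves.ModularForms.ModularParametrizationData W₀ N),
      (∀ z ∈ D₀.L.lattice, ∃ w ∈ Literature.NumberTheory.EllipticCurves.ModularForms.periodLattice D₀.f, z = D₀.c * w) →
      (∀ (W₂ : WeierstrassCurve ℚ) [W₂.IsElliptic]
        (D₂ : Literature.NumberTheory.EllipticCurves.ModularForms.ModularParametrizationData W₂ N),
        D₂.f = D₀.f → D₀.modularDegree ≤ D₂.modularDegree) →
      (∀ r : ℚ, Literature.NumberTheory.EllipticCurves.ratPlusSymbol D₀.f r ≠ 0 →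
        0 ≤ padicValRat 3 (Literature.NumberTheory.EllipticCurves.ratPlusSymbol D₀.f r)) →
      Literature.NumberTheory.EllipticCurves.kuriharaVanishingOrder W₀ 3 D₀.f = 0 →
      ¬ (haveI : Fact (Nat.Prime 3) := ⟨Nat.prime_three⟩;
          Literature.NumberTheory.EllipticCurves.Rank1Residual.Addv W₀ 3) →
      Literature.NumberTheory.EllipticCurves.kuriharaPartialDeepInfty W₀ 3 D₀.f ≤
        Literature.NumberTheory.EllipticCurves.kuriharaPartialInfty W₀ 3 D₀.f

/-! ### The displayed hypothesis (section variable): hKatoPosʷ = «Kato-only ∧ POS», all tower rows -/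

section OfPosition

variable (hKatoPos :
    ∀ (W : WeierstrassCurve ℚ) [W.IsElliptic] [W.IsGloballyMinimal]
        [ContinuousSMul ℤ_[3] (W.tateModule 3)] [Module.Free ℤ_[3] (W.tateModule 3)]
        [Module.Finite ℤ_[3] (W.tateModule 3)],
        (∀ m : ℕ, W.HasSurjectiveModNGaloisRep (3 ^ m : ℕ)) →
        ∀ {N : ℕ} [NeZero N] (P : ModularParametrizationData W N), N = W.conductorNorm ℤ →
          (∀ z ∈ P.L.lattice, ∃ w ∈ periodLattice P.f, z = P.c * w) →
          haveI : Fact (((3 : ℕ) : 𝓞 ℚ) ∈ ((Rat.HeightOneSpectrum.primesEquiv (R := 𝓞 ℚ)).symm ⟨3, Fact.out⟩).asIdeal) :=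
            ⟨(natCast_mem_asIdeal_iff_eq_primesEquiv_symm _ Nat.prime_three).mpr rfl⟩
          letI := valuativeRelPlace ((Rat.HeightOneSpectrum.primesEquiv (R := 𝓞 ℚ)).symm ⟨3, Fact.out⟩)
          letI := topologicalSpacePlace ((Rat.HeightOneSpectrum.primesEquiv (R := 𝓞 ℚ)).symm ⟨3, Fact.out⟩)
          haveI := isNonarchimedeanLocalField_place ((Rat.HeightOneSpectrum.primesEquiv (R := 𝓞 ℚ)).symm ⟨3, Fact.out⟩)
          haveI := charZero_place ((Rat.HeightOneSpectrum.primesEquiv (R := 𝓞 ℚ)).symm ⟨3, Fact.out⟩)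
          letI := padicAlgebraPlace 3 ((Rat.HeightOneSpectrum.primesEquiv (R := 𝓞 ℚ)).symm ⟨3, Fact.out⟩)
          haveI := fact_not_isUnit_place 3 ((Rat.HeightOneSpectrum.primesEquiv (R := 𝓞 ℚ)).symm ⟨3, Fact.out⟩)
          haveI := isAdicComplete_place 3 ((Rat.HeightOneSpectrum.primesEquiv (R := 𝓞 ℚ)).symm ⟨3, Fact.out⟩)
          ∃ (d : LocalNeronLineAt W 3 ((Rat.HeightOneSpectrum.primesEquiv (R := 𝓞 ℚ)).symm ⟨3, Fact.out⟩)),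
          ∃ (ι : (n : ℕ) → (CyclotomicField n ℚ →+* ℂ)) (κK : ℝ)
            (Λ : ∀ (k' : ℕ) (r : Finset (HeightOneSpectrum (𝓞 ℚ))),
              H1 (tateRep W 3) (cycSubgroup 3 k' r) →ₗ[ℤ_[3]]
                ℚ_[3] ⊗[ℚ] CyclotomicField (cycLevel 3 k' r) ℚ),
            κK ≠ 0 ∧
            (∃ u : ℚ, (u : ℝ) = κK ∧
              ∀ (hinj : (bdRPeriodRingData (valuation_place_lt_one 3 ((Rat.HeightOneSpectrum.primesEquiv (R := 𝓞 ℚ)).symm ⟨3, Fact.out⟩))).CupLogInjective (logCyclotomic 3)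
              (localRationalTateRep W 3 (galRestrictPlace ((Rat.HeightOneSpectrum.primesEquiv (R := 𝓞 ℚ)).symm ⟨3, Fact.out⟩))))
              (hex : ∀ z : contOneCocycles (localRationalTateRep W 3 (galRestrictPlace ((Rat.HeightOneSpectrum.primesEquiv (R := 𝓞 ℚ)).symm ⟨3, Fact.out⟩))).toTopRep,
              (bdRPeriodRingData (valuation_place_lt_one 3 ((Rat.HeightOneSpectrum.primesEquiv (R := 𝓞 ℚ)).symm ⟨3, Fact.out⟩))).HasDualExp (logCyclotomic 3)
              (localRationalTateRep W 3 (galRestrictPlace ((Rat.HeightOneSpectrum.primesEquiv (R := 𝓞 ℚ)).symm ⟨3, Fact.out⟩))) fun σ => z.1 σ)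
                (e : ((Rat.HeightOneSpectrum.primesEquiv (R := 𝓞 ℚ)).symm ⟨3, Fact.out⟩).adicCompletion ℚ) (he : e ≠ 0),
                (∀ a : ℚ_[3], (∃ y, (expStarOmegaPadicAt (d.smul e he) hinj hex (((Padic.adicCompletionEquiv (𝓞 ℚ) ⟨3, Fact.out⟩).symm : (((Rat.HeightOneSpectrum.primesEquiv (R := 𝓞 ℚ)).symm ⟨3, Fact.out⟩).adicCompletion ℚ) →+* ℚ_[3]))) y = a) ↔
                  ∀ Q : (W.baseChange ℚ_[3]).toAffine.Point, ‖a * padicLog (W.baseChange ℚ_[3]) Q‖ ≤ 1) →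
                padicValRat 3 u = ((((Padic.adicCompletionEquiv (𝓞 ℚ) ⟨3, Fact.out⟩).symm : (((Rat.HeightOneSpectrum.primesEquiv (R := 𝓞 ℚ)).symm ⟨3, Fact.out⟩).adicCompletion ℚ) →+* ℚ_[3])) e).valuation) ∧
            (∀ (j : ℕ) (r : Finset (HeightOneSpectrum (𝓞 ℚ)))
              (Ψ : ℚ_[3] ⊗[ℚ] CyclotomicField (cycLevel 3 0 r) ℚ ≃ₐ[ℚ]
                (Π w : ((Rat.HeightOneSpectrum.primesEquiv (R := 𝓞 ℚ)).symm ⟨3, Fact.out⟩).Extension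
                  (𝓞 (CyclotomicField (cycLevel 3 0 r) ℚ)), w.1.adicCompletion (CyclotomicField (cycLevel 3 0 r) ℚ)))
              (hΨ : ∀ (s : ℚ_[3]) (x : CyclotomicField (cycLevel 3 0 r) ℚ)
                (w : ((Rat.HeightOneSpectrum.primesEquiv (R := 𝓞 ℚ)).symm ⟨3, Fact.out⟩).Extension
                  (𝓞 (CyclotomicField (cycLevel 3 0 r) ℚ))),
                Ψ (s ⊗ₜ[ℚ] x) w =
                  algebraMap (CyclotomicField (cycLevel 3 0 r) ℚ) (w.1.adicCompletion (CyclotomicField (cycLevel 3 0 r) ℚ)) x *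
                  algebraMap (((Rat.HeightOneSpectrum.primesEquiv (R := 𝓞 ℚ)).symm ⟨3, Fact.out⟩).adicCompletion ℚ)
                    (w.1.adicCompletion (CyclotomicField (cycLevel 3 0 r) ℚ)) ((Padic.adicCompletionEquiv (𝓞 ℚ) ⟨3, Fact.out⟩) s)),
              ∃ (w₀ : ((Rat.HeightOneSpectrum.primesEquiv (R := 𝓞 ℚ)).symm ⟨3, Fact.out⟩).Extension
                  (𝓞 (CyclotomicField (cycLevel 3 0 r) ℚ)))
                (g : ((Rat.HeightOneSpectrum.primesEquiv (R := 𝓞 ℚ)).symm ⟨3, Fact.out⟩).Extension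
                  (𝓞 (CyclotomicField (cycLevel 3 0 r) ℚ)) → absoluteGaloisGroup ℚ)
                (hg : ∀ w : ((Rat.HeightOneSpectrum.primesEquiv (R := 𝓞 ℚ)).symm ⟨3, Fact.out⟩).Extension
                  (𝓞 (CyclotomicField (cycLevel 3 0 r) ℚ)),
                  sigma (cycLevel 3 0 r) (modNCyclotomicCharacter ℚ (cycLevel 3 0 r) (g w)) • w.1 = w₀.1),
                  letI := LocalField.charZero_adicCompletion w₀.1
                  letI := LocalField.adicCompletionPadicAlgebra w₀.1 3 (three_mem_asIdeal_extension _ w₀)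
                  haveI : Fact (¬ IsUnit ((3 : ℕ) : integerC (w₀.1.adicCompletion (CyclotomicField (cycLevel 3 0 r) ℚ)))) :=
                    ⟨not_isUnit_natCast_integerC (LocalField.valuation_adicCompletion_natCast_lt_one w₀.1 3 (three_mem_asIdeal_extension _ w₀))⟩
                  haveI := isAdicComplete_integerC_natCast (LocalField.valuation_adicCompletion_natCast_lt_one w₀.1 3 (three_mem_asIdeal_extension _ w₀))
                  ∃ (dw : LocalNeronLine W (LocalField.valuation_adicCompletion_natCast_lt_one w₀.1 3 (three_mem_asIdeal_extension _ w₀))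
                    ((galRestrictPlace ((Rat.HeightOneSpectrum.primesEquiv (R := 𝓞 ℚ)).symm ⟨3, Fact.out⟩)).comp
                      (absGaloisRestrict (((Rat.HeightOneSpectrum.primesEquiv (R := 𝓞 ℚ)).symm ⟨3, Fact.out⟩).adicCompletion ℚ) (w₀.1.adicCompletion (CyclotomicField (cycLevel 3 0 r) ℚ)))))
                    (hinjw : (bdRPeriodRingData (LocalField.valuation_adicCompletion_natCast_lt_one w₀.1 3 (three_mem_asIdeal_extension _ w₀))).CupLogInjective
                    (logCyclotomic 3) (localRationalTateRep W 3 ((galRestrictPlace ((Rat.HeightOneSpectrum.primesEquiv (R := 𝓞 ℚ)).symm ⟨3, Fact.out⟩)).comp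
                      (absGaloisRestrict (((Rat.HeightOneSpectrum.primesEquiv (R := 𝓞 ℚ)).symm ⟨3, Fact.out⟩).adicCompletion ℚ) (w₀.1.adicCompletion (CyclotomicField (cycLevel 3 0 r) ℚ))))))
                    (hexw : ∀ z : contOneCocycles (localRationalTateRep W 3 ((galRestrictPlace ((Rat.HeightOneSpectrum.primesEquiv (R := 𝓞 ℚ)).symm ⟨3, Fact.out⟩)).comp
                      (absGaloisRestrict (((Rat.HeightOneSpectrum.primesEquiv (R := 𝓞 ℚ)).symm ⟨3, Fact.out⟩).adicCompletion ℚ) (w₀.1.adicCompletion (CyclotomicField (cycLevel 3 0 r) ℚ))))).toTopRep,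
                    (bdRPeriodRingData (LocalField.valuation_adicCompletion_natCast_lt_one w₀.1 3 (three_mem_asIdeal_extension _ w₀))).HasDualExp
                      (logCyclotomic 3) (localRationalTateRep W 3 ((galRestrictPlace ((Rat.HeightOneSpectrum.primesEquiv (R := 𝓞 ℚ)).symm ⟨3, Fact.out⟩)).comp
                      (absGaloisRestrict (((Rat.HeightOneSpectrum.primesEquiv (R := 𝓞 ℚ)).symm ⟨3, Fact.out⟩).adicCompletion ℚ) (w₀.1.adicCompletion (CyclotomicField (cycLevel 3 0 r) ℚ))))) fun σ => z.1 σ),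
                    (∀ (h : (tateLocalRep W 3 (Sum.inr ((Rat.HeightOneSpectrum.primesEquiv (R := 𝓞 ℚ)).symm ⟨3, Fact.out⟩))).cohomology 1),
                    (expStarOmegaHom (LocalField.valuation_adicCompletion_natCast_lt_one w₀.1 3 (three_mem_asIdeal_extension _ w₀))
                      ((galRestrictPlace ((Rat.HeightOneSpectrum.primesEquiv (R := 𝓞 ℚ)).symm ⟨3, Fact.out⟩)).comp
                      (absGaloisRestrict (((Rat.HeightOneSpectrum.primesEquiv (R := 𝓞 ℚ)).symm ⟨3, Fact.out⟩).adicCompletion ℚ) (w₀.1.adicCompletion (CyclotomicField (cycLevel 3 0 r) ℚ)))) dw hinjw hexw)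
                      (ContinuousRep.cohomologyRes (tateLocalRep W 3 (Sum.inr ((Rat.HeightOneSpectrum.primesEquiv (R := 𝓞 ℚ)).symm ⟨3, Fact.out⟩)))
                        (absGaloisRestrict (((Rat.HeightOneSpectrum.primesEquiv (R := 𝓞 ℚ)).symm ⟨3, Fact.out⟩).adicCompletion ℚ) (w₀.1.adicCompletion (CyclotomicField (cycLevel 3 0 r) ℚ))) 1 h) =
                    algebraMap (((Rat.HeightOneSpectrum.primesEquiv (R := 𝓞 ℚ)).symm ⟨3, Fact.out⟩).adicCompletion ℚ) (w₀.1.adicCompletion (CyclotomicField (cycLevel 3 0 r) ℚ)) (expStarOmegaAt d h)) ∧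
                    (∀ (w : ((Rat.HeightOneSpectrum.primesEquiv (R := 𝓞 ℚ)).symm ⟨3, Fact.out⟩).Extension
                      (𝓞 (CyclotomicField (cycLevel 3 0 r) ℚ)))
                    (y : H1 (tateRep W 3) (cycSubgroup 3 0 r))
                    (φ'' : contOneCocycles (subgroupRep (tateRep W 3).toTopRep (cycSubgroup 3 0 r)))
                    (ψT : contOneCocycles ((tateLocalRep W 3 (Sum.inr ((Rat.HeightOneSpectrum.primesEquiv (R := 𝓞 ℚ)).symm ⟨3, Fact.out⟩))).restrict
                      (absGaloisRestrict (((Rat.HeightOneSpectrum.primesEquiv (R := 𝓞 ℚ)).symm ⟨3, Fact.out⟩).adicCompletion ℚ) (w₀.1.adicCompletion (CyclotomicField (cycLevel 3 0 r) ℚ)))).toTopRep),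
                    oneCocycleClass _ φ'' = conjMap (tateRep W 3).toTopRep (cycSubgroup 3 0 r) (g w) 1 y →
                    (∀ σ, ψT.1 σ = φ''.1 ⟨absGaloisRestrictTower ℚ (((Rat.HeightOneSpectrum.primesEquiv (R := 𝓞 ℚ)).symm ⟨3, Fact.out⟩).adicCompletion ℚ) (w₀.1.adicCompletion (CyclotomicField (cycLevel 3 0 r) ℚ)) σ,
                      absGaloisRestrictTower_adicCompletion_mem_cycSubgroup r w₀ σ⟩) →
                    Ψ (Λ 0 r y) w = galAdicCompletionMap
                      (sigma (cycLevel 3 0 r) (modNCyclotomicCharacter ℚ (cycLevel 3 0 r) (g w)))⁻¹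
                      (inv_smul_eq_of_smul_eq (hg w))
                      ((expStarOmegaHom (LocalField.valuation_adicCompletion_natCast_lt_one w₀.1 3 (three_mem_asIdeal_extension _ w₀))
                      ((galRestrictPlace ((Rat.HeightOneSpectrum.primesEquiv (R := 𝓞 ℚ)).symm ⟨3, Fact.out⟩)).comp
                      (absGaloisRestrict (((Rat.HeightOneSpectrum.primesEquiv (R := 𝓞 ℚ)).symm ⟨3, Fact.out⟩).adicCompletion ℚ) (w₀.1.adicCompletion (CyclotomicField (cycLevel 3 0 r) ℚ)))) dw hinjw hexw) (oneCocycleClass _ ψT)))) ∧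
            ∀ (c d a : ℤ) (A : ℕ), 0 < A → Int.gcd c (6 * 3 * A) = 1 → Int.gcd d (6 * 3 * N) = 1 →
              ∃ (z : ∀ (k' : ℕ) (r : (cyclotomicLevelsRat 3 (badPlaces c d A N)).Ideals),
                    H1 (tateRep W 3) ((cyclotomicLevelsRat 3 (badPlaces c d A N)).level k' r.1))
                (x : ∀ (k' : ℕ) (r : (cyclotomicLevelsRat 3 (badPlaces c d A N)).Ideals),
                    CyclotomicField (cycLevel 3 k' r.1) ℚ),
                ZetaBody W 3 P.f ι κK Λ c d a A z x)

include hKatoPos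

/-- **Item 20275 `DefinedKatoWeightedNonAdditiveThree` BY NAME ⟸ (P123) ∧ (DR) ∧ (S5b) ∧ (S5a) ∧ (S5b-tower) ∧ hKatoPosʷ** — gen 11's
`definedKatoWeighted_of_katoV2_of_facts` row by row on `katoV2W_of_katoPosW_of_facts`.  CONDITIONAL; nothing booked.
[cite: Kato2004Asterisque, (8.1.3) (p. 180), §9.4 (p. 188), Thm. 9.7 (p. 189) and Ex. 13.3 (pp. 224–225)]
[cite: BlochKato1990, §3 Prop. 3.8, Ex. 3.11] [cite: Kato1993LNM1553, Ch. II §1.2.4 and Thm. 1.4.1] -/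
theorem definedKatoWeightedNonAdditiveThree_of_katoPos_of_facts (hP : cupLogInjective_and_hasDualExp_of_isDeRham)
    (hDR : isDeRham_restrictedRationalTateRep) (hT : exists_smul_range_expStarCoord_iff_trace_log)
    (hS : expStarCoord_eq_zero_iff_kummer) (hT₂ : exists_smul_range_expStarCoord_tower_iff_trace_log) :
    DefinedKatoWeightedNonAdditiveThree := by
  intro W₀ _ _ htow _ N _ hN D₀ hlat _ _ v₃ hv₃ _ _ _
  exact definedKatoWeighted_of_katoV2_of_facts hS hT₂ (katoV2W_of_katoPosW_of_facts hP hDR hT hKatoPos) W₀ htow v₃ hv₃ D₀ hN hlat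

/-- **Item 20397 `FineKatoTauAnomalousThree` BY NAME ⟸ (P123) ∧ (DR) ∧ (S5b) ∧ (S5a) ∧ (S5b-tower) ∧ hKatoPosʷ** (this seat's
`fineKatoTauAnomalousThree_of_katoV2_of_facts` on `katoV2W_of_katoPosW_of_facts`).  CONDITIONAL; nothing booked.
[cite: Kato2004Asterisque, (8.1.3) (p. 180), §9.4 (p. 188), Thm. 9.7 (p. 189) and Ex. 13.3 (pp. 224–225)]
[cite: BlochKato1990, §3 Prop. 3.8, Ex. 3.11] [cite: Kim2022StructureSelmer, Lemma 3.4, Cor. 3.5, Thm. 3.13] -/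
theorem fineKatoTauAnomalousThree_of_katoPos_of_facts (hP : cupLogInjective_and_hasDualExp_of_isDeRham)
    (hDR : isDeRham_restrictedRationalTateRep) (hT : exists_smul_range_expStarCoord_iff_trace_log)
    (hS : expStarCoord_eq_zero_iff_kummer) (hT₂ : exists_smul_range_expStarCoord_tower_iff_trace_log) :
    FineKatoTauAnomalousThree :=
  fineKatoTauAnomalousThree_of_katoV2_of_facts (katoV2W_of_katoPosW_of_facts hP hDR hT hKatoPos) hS hT₂

/-- **`stub_nonAdditive` of crux 19599 (BC3 text, VERBATIM) ⟸ [S24](1)(2) ∧ GZK ∧ PT ∧ (P123) ∧ (DR) ∧ (S5b) ∧ (S5a) ∧ (S5b-tower) ∧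
hKatoPosʷ** — every non-additive `t = 0` tower row.  CONDITIONAL; nothing booked.
[cite: Kim2025RefinedTNC, Thm 1.2] [cite: Kim2022StructureSelmer, Thm. 1.9 (6), §3.2.3, Thm. 3.13] [cite: Sakamoto2024, Thm. 4.4 (p. 926)]
[cite: MazurRubin2004, Thm. 5.2.12] [cite: Kato2004Asterisque, §9.4 (p. 188), Thm. 9.7 (p. 189)] -/
theorem stub19599_nonAdditive_of_katoPos_of_facts
    (hS24 : Sakamoto2024.kolyvaginSystems_freeRankOne_zmod_three_pow)
    (hS24₂ : Sakamoto2024.kolyvaginSystems_idealOfBasis_eq_fittingIdeal_zmod_three_pow)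
    (hGZK : rank_eq_analyticRank_of_analyticRank_le_one) (hPT : poitouTate_selmerStructure_duality ℚ)
    (hP : cupLogInjective_and_hasDualExp_of_isDeRham) (hDR : isDeRham_restrictedRationalTateRep)
    (hT : exists_smul_range_expStarCoord_iff_trace_log)
    (hS : expStarCoord_eq_zero_iff_kummer) (hT₂ : exists_smul_range_expStarCoord_tower_iff_trace_log) : STUB19599NA :=
  stub19599_nonAdditive_of_katoV2_of_facts (katoV2W_of_katoPosW_of_facts hP hDR hT hKatoPos) hS24 hS24₂ hGZK hPT hS hT₂

/-- **Crux 19599 `ShallowEqDeepOffKatoStratum` BY NAME ⟸ `SakamotoKolyvaginThree ∧ RankEqAnalyticRankLeOne ∧ PoitouTateSelmerDuality` ∧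
(P123) ∧ (DR) ∧ (S5b) ∧ (S5a) ∧ (S5b-tower) ∧ hKatoPosʷ ∧ item 20398.**  CONDITIONAL; nothing booked; 19599 stays OPEN.
[cite: Kim2025RefinedTNC, Thm 1.1, Thm 1.2] [cite: Kim2022StructureSelmer, Thm. 1.9 (6), Thm. 3.13] [cite: Sakamoto2024, Thm. 4.4 (p. 926)]
[cite: MazurRubin2004, Thm. 4.4.1 and Thm. 5.2.12] [cite: Kato2004Asterisque, §9.4 (p. 188), Thm. 9.7 (p. 189), Ex. 13.3] -/
theorem shallowEqDeepOffKatoStratum_of_katoPos_of_facts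
    (hSak : SakamotoKolyvaginThree) (hGZK : RankEqAnalyticRankLeOne) (hPT : PoitouTateSelmerDuality)
    (hP : cupLogInjective_and_hasDualExp_of_isDeRham) (hDR : isDeRham_restrictedRationalTateRep)
    (hT : exists_smul_range_expStarCoord_iff_trace_log)
    (hS : expStarCoord_eq_zero_iff_kummer) (hT₂ : exists_smul_range_expStarCoord_tower_iff_trace_log)
    (h₃ : FineKatoTwoExpDefectThree) : ShallowEqDeepOffKatoStratum :=
  shallowEqDeepOffKatoStratum_of_katoV2_of_facts (katoV2W_of_katoPosW_of_facts hP hDR hT hKatoPos) hSak hGZK hPT hS hT₂ h₃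

/-- **Crux 19077 `ShallowEqDeepAtTorsionFree` BY NAME ⟸ the four route leaves ∧ crux 19560 `KatoKuriharaPortThreeShared` ∧ (P123) ∧
(DR) ∧ (S5b) ∧ (S5a) ∧ (S5b-tower) ∧ hKatoPosʷ ∧ item 20398.**  CONDITIONAL; nothing booked; 19077 stays OPEN.
[cite: Kim2025RefinedTNC, Thm 1.2] [cite: Sakamoto2024, Thm. 4.4 (p. 926)] [cite: MazurRubin2004, Thm. 4.4.1 and Thm. 5.2.12]
[cite: Kato2004Asterisque, Thm. 9.7 (p. 189), Ex. 13.3] [cite: Carayol1986] -/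
theorem shallowEqDeepAtTorsionFree_of_katoPos_of_facts
    (hSak : SakamotoKolyvaginThree) (hGZK : RankEqAnalyticRankLeOne) (hPT : PoitouTateSelmerDuality)
    (hlev : CarayolLevelEqConductor) (hPort : KatoKuriharaPortThreeShared)
    (hP : cupLogInjective_and_hasDualExp_of_isDeRham) (hDR : isDeRham_restrictedRationalTateRep)
    (hT : exists_smul_range_expStarCoord_iff_trace_log)
    (hS : expStarCoord_eq_zero_iff_kummer) (hT₂ : exists_smul_range_expStarCoord_tower_iff_trace_log)
    (h₃ : FineKatoTwoExpDefectThree) : ShallowEqDeepAtTorsionFree :=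
  shallowEqDeepAtTorsionFree_of_katoV2_of_facts (katoV2W_of_katoPosW_of_facts hP hDR hT hKatoPos) hSak hGZK hPT hlev hPort
    hS hT₂ h₃

end OfPosition

end Summit.BirchSwinnertonDyer.BirchSwinnertonDyer.Theorems.KimAtThreeShallowEqDeepNonAdditiveOfPosition

end
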